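import Literature.NumberTheory.EllipticCurves.ShintaniSchwartzFourier
import Literature.NumberTheory.LFunctions.DedekindZetaPoissonProofs
import HarnessLib

/-!
# Theta inversion for Shintani's Schwartz function over lattice cosets

Second file of the formalisation of Shintani's theta lift (see `ShintaniSchwartzFourier` for the
setting and the aim). With the closed-form Fourier transform
`𝓕 f_{w,z} = κ(z) · f_{w,-1/(4z)} ∘ S⁻¹` (`Shintani.fourier_shintaniFn`) and the tree's Poisson
summation formula for full lattices in euclidean spaces
(`Literature.NumberTheory.LFunctions.Fourier.tsum_eq_tsum_fourier_of_rpow_decay`, Neukirch VII (3.2))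
we PROVE the inversion formula behind the weight-`3/2` transformation law of Shintani's theta kernel
(Shintani 1975, Prop. 1.6, the case `σ = (0 -1; 1 0)` up to the normalisation `z ↦ 4z` of the
quadratic form):

* `tsum_shintaniFn_translate` — for every full lattice `Γ ⊂ V = ℝ³`, `w, z ∈ ℍ` and `h ∈ V`,
  `∑_{x ∈ Γ} f_{w,z}(x + h) = covol(Γ)⁻¹ ∑_{ξ ∈ Γ*} e(⟪h, ξ⟫) κ(z) f_{w,-1/(4z)}(S⁻¹ξ)`
  (`Γ*` the dual lattice `Literature.Algebra.EuclideanLattices.dualLattice Γ`, both sides absolutely convergent).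

The analytic inputs proved here are the hypotheses of the Poisson formula for the Schwartz function:
continuity (`continuous_shintaniFn`), the decay `|f_{w,z}(x)| ≤ C (1 + ‖x‖)⁻⁴` (`exists_norm_shintaniFn_le`,
from `|f_{w,z}(x)| = |x(w,1)| e^{-2π Im z · q_w⁺(x)}`, the positivity `c_w ‖x‖² ≤ q_w⁺(x)` of the majorant
— at `w = i` explicitly `‖x‖² ≤ x₁² + 2x₀² + 2x₂²`, in general transported by the determinant-one map
`M_w` of `ShintaniSchwartzFourier` and the boundedness of `M_w⁻¹` — and the elementary bound
`t e^{-at²} ≤ max(96/a³, 16)(1+t)⁻⁴`), the stability of the decay under translation, and the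
summability of the Fourier side over the dual lattice (`‖ξ‖ ≤ 2‖S⁻¹ξ‖`). No named facts are
introduced.

## References

* T. Shintani, *On construction of holomorphic cusp forms of half integral weight*, Nagoya Math. J.
  58 (1975) 83–126, §1.6, Prop. 1.6 (i) (theta transformation formulae from the Weil representation,
  i.e. from Poisson summation). [Shintani1975]
* J. Neukirch, *Algebraic Number Theory*, Ch. VII (3.2) (Poisson summation for lattices; the tree's
  `DedekindZetaPoissonProofs`).
-/

noncomputable section

open Complex MeasureTheory Filter Topology Real Asymptotics
open scoped FourierTransform RealInnerProductSpace

namespace Literature.NumberTheory.EllipticCurves.Shintani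

open UpperHalfPlane hiding I

/-! ## Decay of the Schwartz function -/

/-- The majorant at `i` written out: `q_i⁺(x) = x₁² + 2x₀² + 2x₂²`. [folklore] -/
theorem majorant_I_eq (x : V) : majorant UpperHalfPlane.I x = x 1 ^ 2 + 2 * x 0 ^ 2 + 2 * x 2 ^ 2 := by
  rw [majorant, pw_I, disc]; ring

/-- `‖x‖² = x₀² + x₁² + x₂²` on `ℝ³`. [folklore] -/
theorem norm_sq_eq_sum_three (x : V) : ‖x‖ ^ 2 = x 0 ^ 2 + x 1 ^ 2 + x 2 ^ 2 := by
  rw [EuclideanSpace.norm_sq_eq]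
  simp [Fin.sum_univ_three]

/-- `‖x‖² ≤ q_i⁺(x)`. [folklore] -/
theorem norm_sq_le_majorant_I (x : V) : ‖x‖ ^ 2 ≤ majorant UpperHalfPlane.I x := by
  rw [majorant_I_eq, norm_sq_eq_sum_three]
  nlinarith [sq_nonneg (x 0), sq_nonneg (x 2)]

/-- **Positivity of the majorant**: `c_w ‖x‖² ≤ q_w⁺(x)` for some `c_w > 0`. [folklore] -/
theorem exists_pos_mul_norm_sq_le_majorant (w : ℍ) :
    ∃ c : ℝ, 0 < c ∧ ∀ x : V, c * ‖x‖ ^ 2 ≤ majorant w x := by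
  have hdet : LinearMap.det (mLin w) ≠ 0 := by rw [det_mLin]; exact one_ne_zero
  let e : V ≃L[ℝ] V := (LinearMap.equivOfDetNeZero (mLin w) hdet).toContinuousLinearEquiv
  have he : ∀ x, e x = mLin w x := fun x ↦ rfl
  set A : ℝ := ‖(e.symm : V →L[ℝ] V)‖ + 1 with hA
  have hA0 : 0 < A := by positivity
  refine ⟨1 / A ^ 2, by positivity, fun x ↦ ?_⟩
  have h1 : ‖x‖ ≤ A * ‖mLin w x‖ := by
    have := (e.symm : V →L[ℝ] V).le_opNorm (e x)
    rw [ContinuousLinearEquiv.coe_coe, e.symm_apply_apply, he] at this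
    calc ‖x‖ ≤ ‖(e.symm : V →L[ℝ] V)‖ * ‖mLin w x‖ := this
      _ ≤ A * ‖mLin w x‖ := by gcongr; linarith
  have h2 : ‖mLin w x‖ ^ 2 ≤ majorant w x := by
    rw [← majorant_mLin]; exact norm_sq_le_majorant_I _
  calc 1 / A ^ 2 * ‖x‖ ^ 2 = (‖x‖ / A) ^ 2 := by ring
    _ ≤ ‖mLin w x‖ ^ 2 := by
        gcongr
        rw [div_le_iff₀ hA0]; linarith [h1]
    _ ≤ majorant w x := h2

/-- `|x_i| ≤ ‖x‖` on `ℝ³`. [folklore] -/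
theorem abs_apply_le_norm (x : V) (i : Fin 3) : |x i| ≤ ‖x‖ := by
  have h : x i ^ 2 ≤ ‖x‖ ^ 2 := by
    rw [norm_sq_eq_sum_three]
    fin_cases i <;> simp <;> nlinarith [sq_nonneg (x 0), sq_nonneg (x 1), sq_nonneg (x 2)]
  exact abs_le_of_sq_le_sq' h (norm_nonneg _) |> fun hh ↦ abs_le.mpr hh

/-- `|x(w,1)| ≤ (|w|² + |w| + 1) ‖x‖`. [folklore] -/
theorem norm_formEval_le (w : ℍ) (x : V) :
    ‖formEval x w‖ ≤ (‖(w : ℂ)‖ ^ 2 + ‖(w : ℂ)‖ + 1) * ‖x‖ := by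
  have h0 := abs_apply_le_norm x 0
  have h1 := abs_apply_le_norm x 1
  have h2 := abs_apply_le_norm x 2
  rw [formEval]
  calc ‖(x 0 : ℂ) * (w : ℂ) ^ 2 + (x 1 : ℂ) * w + (x 2 : ℂ)‖
      ≤ ‖(x 0 : ℂ) * (w : ℂ) ^ 2‖ + ‖(x 1 : ℂ) * (w : ℂ)‖ + ‖(x 2 : ℂ)‖ := norm_add₃_le
    _ = |x 0| * ‖(w : ℂ)‖ ^ 2 + |x 1| * ‖(w : ℂ)‖ + |x 2| := by
        simp [norm_pow]
    _ ≤ ‖x‖ * ‖(w : ℂ)‖ ^ 2 + ‖x‖ * ‖(w : ℂ)‖ + ‖x‖ := by gcongr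
    _ = (‖(w : ℂ)‖ ^ 2 + ‖(w : ℂ)‖ + 1) * ‖x‖ := by ring

/-- `t e^{-a t²} ≤ max(96/a³, 16) (1 + t)⁻⁴` for `t ≥ 0`, `a > 0`. [folklore] -/
theorem mul_exp_neg_mul_sq_le {a : ℝ} (ha : 0 < a) {t : ℝ} (ht : 0 ≤ t) :
    t * Real.exp (-(a * t ^ 2)) ≤ max (96 / a ^ 3) 16 * (1 + t) ^ (-(4 : ℝ)) := by
  have h1t : 0 < 1 + t := by linarith
  rw [Real.rpow_neg h1t.le, show (4 : ℝ) = (4 : ℕ) by norm_num, Real.rpow_natCast,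
    ← div_eq_mul_inv, le_div_iff₀ (by positivity)]
  rcases le_or_gt t 1 with h | h
  · -- t ≤ 1
    have hexp : Real.exp (-(a * t ^ 2)) ≤ 1 := by
      rw [Real.exp_le_one_iff]; nlinarith [sq_nonneg t]
    have h16 : (16 : ℝ) ≤ max (96 / a ^ 3) 16 := le_max_right _ _
    have hte : t * Real.exp (-(a * t ^ 2)) ≤ 1 * 1 :=
      mul_le_mul h hexp (Real.exp_pos _).le zero_le_one
    have hp4 : (1 + t) ^ 4 ≤ 2 ^ 4 := pow_le_pow_left₀ h1t.le (by linarith) 4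
    calc t * Real.exp (-(a * t ^ 2)) * (1 + t) ^ 4 ≤ 1 * 1 * 2 ^ 4 :=
          mul_le_mul hte hp4 (by positivity) (by norm_num)
      _ = 16 := by norm_num
      _ ≤ max (96 / a ^ 3) 16 := h16
  · -- t > 1: e^{a t²} ≥ (a t²)³/6
    have hpos : 0 < a * t ^ 2 := by positivity
    have h6 : (a * t ^ 2) ^ 3 / 6 ≤ Real.exp (a * t ^ 2) := by
      have := Real.pow_div_factorial_le_exp (a * t ^ 2) hpos.le 3
      simpa [Nat.factorial] using this
    have hexp : Real.exp (-(a * t ^ 2)) ≤ 6 / (a * t ^ 2) ^ 3 := by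
      rw [Real.exp_neg, inv_eq_one_div, div_le_div_iff₀ (Real.exp_pos _) (by positivity)]
      linarith
    have h14 : (1 + t) ^ 4 ≤ 16 * t ^ 4 := by nlinarith [sq_nonneg (t - 1), sq_nonneg (t + 1), sq_nonneg t]
    have h96 : 96 / a ^ 3 ≤ max (96 / a ^ 3) 16 := le_max_left _ _
    calc t * Real.exp (-(a * t ^ 2)) * (1 + t) ^ 4
        ≤ t * (6 / (a * t ^ 2) ^ 3) * (16 * t ^ 4) := by gcongr
      _ = 96 / a ^ 3 * (1 / t) := by field_simp; ring
      _ ≤ 96 / a ^ 3 * 1 := by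
          gcongr
          rw [div_le_one (by linarith)]; linarith
      _ ≤ max (96 / a ^ 3) 16 := by rw [mul_one]; exact h96


/-- `p⁻⁴ ≤ K⁴ q⁻⁴` when `0 < q ≤ K p`. [folklore] -/
theorem rpow_neg_four_le {p q K : ℝ} (hp : 0 < p) (hq : 0 < q) (h : q ≤ K * p) :
    p ^ (-(4 : ℝ)) ≤ K ^ 4 * q ^ (-(4 : ℝ)) := by
  rw [Real.rpow_neg hp.le, Real.rpow_neg hq.le, show (4 : ℝ) = ((4 : ℕ) : ℝ) by norm_num,
    Real.rpow_natCast, Real.rpow_natCast]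
  have h4 : q ^ 4 ≤ (K * p) ^ 4 := pow_le_pow_left₀ hq.le h 4
  rw [mul_pow] at h4
  rw [inv_eq_one_div, inv_eq_one_div, ← div_eq_mul_one_div, div_le_div_iff₀ (by positivity)
    (by positivity)]
  linarith

/-- Translating the decay weight: `(1 + ‖x + h‖)⁻⁴ ≤ (1 + ‖h‖)⁴ (1 + ‖x‖)⁻⁴`. [folklore] -/
theorem decay_translate (x h : V) :
    (1 + ‖x + h‖) ^ (-(4 : ℝ)) ≤ (1 + ‖h‖) ^ 4 * (1 + ‖x‖) ^ (-(4 : ℝ)) := by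
  refine rpow_neg_four_le (by positivity) (by positivity) ?_
  have : ‖x‖ ≤ ‖x + h‖ + ‖h‖ := by
    calc ‖x‖ = ‖(x + h) - h‖ := by rw [add_sub_cancel_right]
      _ ≤ ‖x + h‖ + ‖h‖ := norm_sub_le _ _
  nlinarith [norm_nonneg (x + h), norm_nonneg h, norm_nonneg x]

/-- `‖ξ‖ ≤ 2 ‖S⁻¹ξ‖`. [folklore] -/
theorem norm_le_two_mul_norm_sinv (ξ : V) : ‖ξ‖ ≤ 2 * ‖sinv ξ‖ := by
  have h : ‖ξ‖ ^ 2 ≤ (2 * ‖sinv ξ‖) ^ 2 := by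
    rw [mul_pow, norm_sq_eq_sum_three, norm_sq_eq_sum_three, sinv_zero, sinv_one, sinv_two]
    nlinarith [sq_nonneg (ξ 1)]
  exact (pow_le_pow_iff_left₀ (norm_nonneg _) (by positivity) two_ne_zero).mp h

/-- `(1 + ‖S⁻¹ξ‖)⁻⁴ ≤ 16 (1 + ‖ξ‖)⁻⁴`. [folklore] -/
theorem decay_sinv (ξ : V) :
    (1 + ‖sinv ξ‖) ^ (-(4 : ℝ)) ≤ (2 : ℝ) ^ 4 * (1 + ‖ξ‖) ^ (-(4 : ℝ)) := by
  refine rpow_neg_four_le (by positivity) (by positivity) ?_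
  linarith [norm_le_two_mul_norm_sinv ξ]

/-- Continuity of the coordinates. [folklore] -/
theorem continuous_apply_V (i : Fin 3) : Continuous fun x : V ↦ x i :=
  (EuclideanSpace.proj i).continuous

/-- `f_{w,z}` is continuous. [folklore] -/
theorem continuous_shintaniFn (w z : ℍ) : Continuous (shintaniFn w z) := by
  have h := continuous_apply_V
  unfold shintaniFn formEval majorant pw disc
  fun_prop

/-- `|f_{w,z}(x)| = |x(w,1)| e^{-2π Im z · q_w⁺(x)}`. [folklore] -/
theorem norm_shintaniFn (w z : ℍ) (x : V) :
    ‖shintaniFn w z x‖ = ‖formEval x w‖ * Real.exp (-(2 * π * z.im * majorant w x)) := by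
  rw [shintaniFn, norm_mul, Complex.norm_exp]
  congr 2
  simp [Complex.mul_re, Complex.mul_im]
  ring

/-- **Decay of the Schwartz function**: `|f_{w,z}(x)| ≤ C (1 + ‖x‖)⁻⁴`. [folklore] -/
theorem exists_norm_shintaniFn_le (w z : ℍ) :
    ∃ C : ℝ, ∀ x : V, ‖shintaniFn w z x‖ ≤ C * (1 + ‖x‖) ^ (-(4 : ℝ)) := by
  obtain ⟨c, hc, hcx⟩ := exists_pos_mul_norm_sq_le_majorant w
  set K : ℝ := ‖(w : ℂ)‖ ^ 2 + ‖(w : ℂ)‖ + 1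
  set a : ℝ := 2 * π * z.im * c with ha
  have ha0 : 0 < a := by have := z.im_pos; positivity
  refine ⟨K * max (96 / a ^ 3) 16, fun x ↦ ?_⟩
  rw [norm_shintaniFn]
  have h1 : ‖formEval x w‖ ≤ K * ‖x‖ := norm_formEval_le w x
  have h2 : Real.exp (-(2 * π * z.im * majorant w x)) ≤ Real.exp (-(a * ‖x‖ ^ 2)) := by
    rw [Real.exp_le_exp, ha]
    have := hcx x
    have := z.im_pos
    nlinarith [Real.pi_pos, mul_pos (mul_pos two_pos Real.pi_pos) z.im_pos]
  calc ‖formEval x w‖ * Real.exp (-(2 * π * z.im * majorant w x))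
      ≤ (K * ‖x‖) * Real.exp (-(a * ‖x‖ ^ 2)) :=
        mul_le_mul h1 h2 (Real.exp_pos _).le (by positivity)
    _ = K * (‖x‖ * Real.exp (-(a * ‖x‖ ^ 2))) := by ring
    _ ≤ K * (max (96 / a ^ 3) 16 * (1 + ‖x‖) ^ (-(4 : ℝ))) :=
        mul_le_mul_of_nonneg_left (mul_exp_neg_mul_sq_le ha0 (norm_nonneg x)) (by positivity)
    _ = K * max (96 / a ^ 3) 16 * (1 + ‖x‖) ^ (-(4 : ℝ)) := by ring


/-! ### Poisson summation for the Shintani–Schwartz function over a lattice coset -/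

open Literature.NumberTheory.LFunctions.Fourier Literature.Algebra.EuclideanLattices in
/-- **Theta inversion for the Shintani–Schwartz function** (Poisson summation over a translate of a
full lattice `Γ ⊂ V`): `∑_{x ∈ Γ} f_{w,z}(x + h) = covol(Γ)⁻¹ κ(z) ∑_{ξ ∈ Γ*} e(⟪h,ξ⟫) f_{w,-1/(4z)}(S⁻¹ξ)`.
[cite: Shintani1975, Prop. 1.6] -/
theorem tsum_shintaniFn_translate (Γ : Submodule ℤ V) [DiscreteTopology Γ] [IsZLattice ℝ Γ]
    (w z : ℍ) (h : V) :
    ∑' x : Γ, shintaniFn w z ((x : V) + h) =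
      ((ZLattice.covolume Γ)⁻¹ : ℝ) • ∑' ξ : dualLattice Γ,
        𝐞 (⟪h, (ξ : V)⟫) • (kappa z * shintaniFn w (invFour z) (sinv ξ)) := by
  set f : V → ℂ := fun x ↦ shintaniFn w z (x + h) with hf
  have hfc : Continuous f := (continuous_shintaniFn w z).comp (continuous_add_const h)
  obtain ⟨C, hC⟩ := exists_norm_shintaniFn_le w z
  have hdec : ∀ x, ‖f x‖ ≤ C * (1 + ‖h‖) ^ 4 * (1 + ‖x‖) ^ (-(4 : ℝ)) := fun x ↦ by
    have hC0 : 0 ≤ C := by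
      have := hC 0
      have h0 : (0 : ℝ) ≤ ‖shintaniFn w z 0‖ := norm_nonneg _
      have h1 : (1 + ‖(0 : V)‖) ^ (-(4 : ℝ)) = 1 := by simp
      rw [h1, mul_one] at this
      linarith
    calc ‖f x‖ = ‖shintaniFn w z (x + h)‖ := rfl
      _ ≤ C * (1 + ‖x + h‖) ^ (-(4 : ℝ)) := hC _
      _ ≤ C * ((1 + ‖h‖) ^ 4 * (1 + ‖x‖) ^ (-(4 : ℝ))) :=
          mul_le_mul_of_nonneg_left (decay_translate x h) hC0
      _ = C * (1 + ‖h‖) ^ 4 * (1 + ‖x‖) ^ (-(4 : ℝ)) := by ring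
  have hF : ∀ ξ : V, 𝓕 f ξ = 𝐞 (⟪h, ξ⟫) • 𝓕 (shintaniFn w z) ξ := fun ξ ↦ by
    have := congrFun (VectorFourier.fourierIntegral_comp_add_right 𝐞 volume (innerₗ V)
      (shintaniFn w z) h) ξ
    exact this
  have hb : (Module.finrank ℝ V : ℝ) < 4 := by
    rw [finrank_euclideanSpace_fin]; norm_num
  obtain ⟨C', hC'⟩ := exists_norm_shintaniFn_le w (invFour z)
  have hsum : Summable fun ξ : dualLattice Γ ↦ 𝓕 f ξ := by
    refine summable_of_decay_zlattice (dualLattice Γ) (C := ‖kappa z‖ * C' * 2 ^ 4) hb fun ξ ↦ ?_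
    rw [hF, fourier_shintaniFn, Circle.norm_smul, norm_mul]
    have hC'0 : 0 ≤ C' := by
      have := hC' 0
      have h1 : (1 + ‖(0 : V)‖) ^ (-(4 : ℝ)) = 1 := by simp
      rw [h1, mul_one] at this
      linarith [norm_nonneg (shintaniFn w (invFour z) 0)]
    calc ‖kappa z‖ * ‖shintaniFn w (invFour z) (sinv ξ)‖
        ≤ ‖kappa z‖ * (C' * (1 + ‖sinv ξ‖) ^ (-(4 : ℝ))) :=
          mul_le_mul_of_nonneg_left (hC' _) (norm_nonneg _)
      _ ≤ ‖kappa z‖ * (C' * ((2 : ℝ) ^ 4 * (1 + ‖ξ‖) ^ (-(4 : ℝ)))) := by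
          gcongr
          exact decay_sinv ξ
      _ = ‖kappa z‖ * C' * 2 ^ 4 * (1 + ‖ξ‖) ^ (-(4 : ℝ)) := by ring
  have main := tsum_eq_tsum_fourier_of_rpow_decay Γ hfc hb hdec hsum
  rw [main]
  congr 1
  refine tsum_congr fun ξ ↦ ?_
  rw [hF, fourier_shintaniFn]

end Literature.NumberTheory.EllipticCurves.Shintani
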